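/-
Copyright: the b2b-balaban cell (near-miss cell 7), T⁴-continuum fan-out, lineage t4-ne7b-p3 (node U5c LARGE-DEVIATION
member P3).  Released under the licence of the surrounding project.
-/
import Summits.QuantumFields.BalabanUV.T4Continuum.Support.SpaceTimeRealisedLin

/-!
# Space-time Peierls ∕ Cramér route for NE7b — NON-VACUITY of `RLin.lineageReadings`: a toy realised family on the
# COUNT carrier inhabiting every hypothesis with a nonempty bad class and a positive weight

Summits-side support leaf of the T⁴-continuum cell (rung (B)+1 on a FINITE torus only; NOT infinite volume, NOT the
mass gap, NOT the Clay statement; NOT a proof of the spine estimate NE7b).  Lineage `t4-ne7b-p3` (generation 3), node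
U5c, skeleton `t4/skeletons/NE7b-t4-ne7b-p3.md` §12.  [folklore] sanity over `SpaceTimeRealisedLin` and the COUNT
swarm's `HistoryAdmissible` ∕ `HistoryRealise` (by name); numerals never enter the route; nothing printed is asserted;
no `[cite:]` tag.

WHAT.  `toyR`: `d = 1`, `n = 1`, `L = 4`, `Kx = K = 0`, `ℓ = id`, one term with one lineage whose history is the
BIRTH at step `0` of the unit region `{0}` of class `0` anchored at `0`, realised by `{0}`, constant flow `s ≡ 0`.
**`lineageReadings_witnessR`**: for ANY printed-shape constants with merger allowance `n₁ ≥ 13`, any genealogy cutoff,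
any sizes `R ≥ 1` and any couplings, the hypotheses of `RLin.lineageReadings` — flow side conditions, nonnegativity,
rooting of the bad term at step `0`, `LatSep`, `Realises ∧ PendingAt ∧ TypeNodup ∧ RenewAtReach`, factorisation with
equality, remainder `1` — are ALL discharged on the toy, giving `LineageReadings` with the NONEMPTY bad class `{τ₀}`
and the POSITIVE weight `e^{−(credits − lifeCost)(born (0,0,0) 0)}`.  So the hypothesis list of the junction theorem
is jointly satisfiable with a non-trivial conclusion (no hypothesis is vacuously false).

HONEST DEPENDENCY (cell, verbatim): continuum YM on T⁴ ⇐ BetaPertH ∧ nine spine estimates (0/9 proved); BetaPertH ⇐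
(D1) ∧ (D4) ∧ CAP+tail; G-an2-4 gates asym, D1 and NE2/3/4.  This file changes none of it.
-/

open Finset

namespace Summit.QuantumFields.BalabanUV.T4Continuum.SpaceTimePeierls

open Literature.MathematicalPhysics.QuantumFieldTheory.Balaban1983to89
open Literature.MathematicalPhysics.QuantumFieldTheory.Balaban1983to89.B13ScaleTransfer
open Literature.MathematicalPhysics.QuantumFieldTheory.Balaban1983to89.B16SProfile
open Literature.MathematicalPhysics.QuantumFieldTheory.Balaban1983to89.TreeLength
open T4PersistenceDictionary T4BankedInduction T4PrintedShapeBanking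
open Summit.QuantumFields.BalabanUV.T4Continuum.ZoneTorus
open Summit.QuantumFields.BalabanUV.T4Continuum.HistoryAdmissible
open Summit.QuantumFields.BalabanUV.T4Continuum.HistoryRealise
open SpaceTimePeierlsLeaves

noncomputable section

open Classical

namespace WitnessR

/-- the toy history: the unit region `{0} ⊆ ℤ¹` of class `0`, anchored at `0`, born at step `0` [folklore] -/
def P₀ : PGen (Pt 1 × Finset (Pt 1)) := .birth 0 0 ((0 : Pt 1), {(0 : Pt 1)})

/-- **THE TOY REALISED LINEAGE DATA**: `d = 1`, `n = 1`, `L = 4`, `Kx = K = 0`, `ℓ = id`; one term, one lineage with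
history `P₀` realised by `{0}`, constant flow exponents `0`. [folklore] -/
def toyR : RLin 1 1 4 0 0 (fun u => u) Unit Unit where
  hN := by norm_num
  hℓK := fun _ hu => hu
  T := {()}
  fam := fun _ => {()}
  P := fun _ => P₀
  Z := fun _ => {(0 : Pt 1)}
  s := fun _ => 0

/-- the toy history is realised by its region [folklore] -/
theorem realises_toy (R : ℕ → ℕ) : Realises 4 toyR.s R (toyR.P ()) (toyR.Z ()) := by
  show Realises 4 (fun _ => 0) R P₀ {(0 : Pt 1)}
  refine ⟨rfl, mem_singleton_self _, fun x hx y hy => ?_, ?_⟩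
  · have hx' : x = 0 := mem_singleton.1 hx
    have hy' : y = 0 := mem_singleton.1 hy
    subst hx'; subst hy'
    exact Relation.ReflTransGen.refl
  · rw [treeLen_singleton]
    exact Nat.cast_nonneg _

/-- the toy history is pending at the cutoff `0` (a stop needs a positive index) [folklore] -/
theorem pendingAt_toy (R : ℕ → ℕ) : PendingAt 4 toyR.s R (toyR.P ()).lastStep (toyR.Z ()) 0 := by
  refine ⟨le_rfl, fun k hk hst => ?_⟩
  have h1 := hst.pos
  have h2 : k ≤ 0 := by simpa [toyR, P₀, PGen.lastStep] using hk
  omega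

/-- the toy history has distinct event types and (vacuously) renews at the booked reach [folklore] -/
theorem typeNodup_toy (W : PEv → ℕ) : (toyR.P ()).TypeNodup ∧ (toyR.P ()).RenewAtReach W :=
  ⟨Multiset.nodup_singleton _, trivial⟩

end WitnessR

open WitnessR

/-- **NON-VACUITY OF `RLin.lineageReadings`.**  For any printed-shape constants with `n₁ ≥ 13`, any genealogy cutoff,
sizes `R ≥ 1` and couplings, the toy realised data carry the lineage readings with the NONEMPTY bad class `{τ₀}` and
the POSITIVE weight `A τ₀ = e^{−(credits − lifeCost)(P₀.toGen)}` (remainder `1`, envelope `1`, `c₃ = 0`) — obtained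
THROUGH the junction theorem, every one of whose hypotheses is discharged on the toy. [folklore] -/
theorem lineageReadings_witnessR (C : T4PrintedShapeBanking.Consts) (hn₁ : 13 ≤ C.n₁) (Kc : ℕ) (R : ℕ → ℕ)
    (hR : ∀ t, 1 ≤ R t) (g : ℕ → ℝ) :
    ∃ (A : Unit → ℝ) (Bad : Finset Unit), Bad.Nonempty ∧ (∀ τ ∈ Bad, 0 < A τ) ∧
      LineageReadings toyR.toLinData.model C 0 Kc R g A Bad 0 1 (3 ^ 1 + 4 ^ (2 * 1) + 1)
        ((((3 ^ 1 + 4 ^ (2 * 1) + 1 : ℕ) : ℝ) + 1) ^ 2) (((1 * 4 ^ (0 - 0)) ^ 1 : ℕ) : ℝ) (8 * 126 ^ 1) (126 ^ 1)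
        ((127 : ℝ) ^ 1 + 3) 0 := by
  set A : Unit → ℝ := fun _ =>
    Real.exp (-(credits (credit C g) P₀.toGen - lifeCost (dictW R C.n₁) (cost C Kc R) P₀.toGen)) with hA
  refine ⟨A, {()}, ⟨(), mem_singleton_self _⟩, fun τ _ => Real.exp_pos _, ?_⟩
  refine toyR.lineageReadings (rest := fun _ _ => 1) (by norm_num) le_rfl (fun u => Nat.le_succ u)
    (fun u => by omega) (fun u => ?_) (fun m => B16Absorption.dropCtl_const 0 m) hR hn₁ (Nat.zero_le _)
    (fun τ _ => (Real.exp_pos _).le) (subset_refl _) le_rfl (fun τ _ => ?_) ?_ (fun τ _ lam _ => ?_)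
    (fun 𝒦 τ _ _ lam _ _ => ?_) (fun _ τ _ => zero_le_one) (fun 𝒦 => ?_)
  · -- the flow: `ratio 4 0 u = 4 = 4^{(u+1) − u}`
    show ratio 4 (fun _ => 0) u = 4 ^ (u + 1 - u)
    simp [ratio, qexp]
  · -- (ii′) the bad term's lineage is rooted at step `0`
    exact ⟨(), mem_singleton_self _, le_rfl⟩
  · -- (iii′) lateral separation: one lineage per term
    exact fun τ _ lam₁ _ lam₂ _ hne => absurd (Subsingleton.elim lam₁ lam₂) hne
  · -- (iv′) realised, pending, distinct types, renewal at reach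
    cases lam
    exact ⟨realises_toy R, pendingAt_toy R, typeNodup_toy _⟩
  · -- (v′) factorisation with equality
    cases lam
    show A τ ≤ Real.exp (-(credits (credit C g) P₀.toGen - lifeCost (dictW R C.n₁) (cost C Kc R) P₀.toGen)) * 1
    rw [mul_one]
  · -- (vi) remainder: one term, `rest = 1`, `c₃ = 0`, `nup = 1`
    rw [Real.exp_zero, one_pow, one_mul]
    calc ∑ τ ∈ toyR.toLinData.model.T.filter (fun τ => toyR.toLinData.model.IsContour τ 𝒦), (1 : ℝ)
        ≤ ∑ τ ∈ toyR.toLinData.model.T, (1 : ℝ) :=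
          sum_le_sum_of_subset_of_nonneg (filter_subset _ _) fun _ _ _ => zero_le_one
      _ = 1 := by
          show ∑ τ ∈ ({()} : Finset Unit), (1 : ℝ) = 1
          simp

end

end Summit.QuantumFields.BalabanUV.T4Continuum.SpaceTimePeierls
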